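import Literature.MathematicalPhysics.QuantumLattice.GrassmannFlowStepDB
import HarnessLib

/-!
# The near-identity step: `effAction C W − W` for a covariance with SMALL entries and row sums, in every degree

Topic `MathematicalPhysics/QuantumLattice`; continuation of `GrassmannFlowStepDB` (which treats the top degree of a polynomial interaction).  For a
replica-Gram-bounded covariance `C` (constant `κ`) with row and column sums of `‖C‖` at most `α` and entries at most `s`, and an even input
`W` without constant part whose kernels have pinned `L¹` profile `N` (all degrees), the kernels of the DIFFERENCE `effAction C W − W` obey, in
every degree `m ≥ 1` and at every pinned leg,
`Σ_{X : X_i = w} ‖kernel (effAction C W) m X − kernel W m X‖ ≤ Σ_{1 ≤ j ≤ |Γ|} ((m+2j)!/(m! j! 2^j)) s^j N(m+2j) + ρ^{-m} e‖W‖_h θ/(1−θ)`,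
`θ = eα‖W‖_h/κ²` (Benfatto–Giuliani–Mastropietro 2006, (2.86)–(2.90): linear part = Wick self-contractions, each costing the sup entry `s`
(`GrassmannGaussConvKernelBound.sum_norm_kernel_gaussConv_sub_le`); nonlinear part second order
(`GrassmannEffectiveActionTruncationDB.sum_norm_kernel_effAction_sub_gaussConv_le_of_gramBounded`)) — so the step is CLOSE TO THE IDENTITY when
`s` and `α` are small at fixed `κ`: the near half of the defect-covariance step of a nested two-volume comparison (interior entries and row sums
of the defect `C_{bL} − C^dec` are `O(m₁/L)` by nested Poisson summation).

* **`sum_norm_kernel_effAction_sub_self_le_of_gramBounded`** — the displayed bound (also returns `IsUnit Z`).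

Everything is proved; no definition, no named fact.

## Sources
G. Benfatto, A. Giuliani, V. Mastropietro, Ann. Henri Poincaré 7 (2006) 809–898, (2.13)–(2.14), (2.86)–(2.90) [`BenfattoGiulianiMastropietro2006`];
K. Gawȩdzki, A. Kupiainen, Comm. Math. Phys. 102 (1985) 1–30, §3 [`GawedzkiKupiainen1985GrossNeveu`].
-/

noncomputable section

namespace Literature.MathematicalPhysics.QuantumLattice

open GrassmannAlgebra Finset Literature.Probability.LatticeModels
open scoped Nat

universe u

variable {𝕜 : Type*} [RCLike 𝕜] {Γ : Type u} [Fintype Γ] [DecidableEq Γ] (C : Matrix Γ Γ 𝕜)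

/-- **THE NEAR-IDENTITY STEP** (BGM 2006, (2.86)–(2.90), every degree): for a replica-Gram-bounded `C` (constant `κ`) with row/column sums `≤ α`,
entries `≤ s`, and an even `W` without constant part with pinned kernel profile `N` in all degrees, `θ = eα‖W‖_h/κ² < 1`
(`‖W‖_h = normV Γ κ ρ (m' ↦ N (2m'))`): `Z` is a unit and in every degree `m ≥ 1`, one leg pinned,
`Σ_{X : X_i = w} ‖kernel (effAction C W) m X − kernel W m X‖ ≤ Σ_{1 ≤ j < |Γ|+1} ((m+2j)!/(m! j! 2^j)) s^j N(m+2j) + ρ^{-m} e‖W‖_h θ/(1−θ)`.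
[cite: BenfattoGiulianiMastropietro2006, (2.86)-(2.90)] -/
theorem sum_norm_kernel_effAction_sub_self_le_of_gramBounded {κ : ℝ} (hκ : 0 < κ) (hGB : IsGramBoundedR C κ)
    (W : GrassmannAlgebra 𝕜 Γ) (hW : W ∈ evenPart 𝕜 Γ) (hW0 : constPart 𝕜 W = 0) (N : ℕ → ℝ) (hN0 : ∀ n, 0 ≤ N n)
    (hN : ∀ (n : ℕ) (p : Fin n) (w : Γ), ∑ Z ∈ univ.filter (fun Z : Fin n → Γ => Z p = w), ‖kernel 𝕜 W n Z‖ ≤ N n)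
    {α : ℝ} (hα : 0 < α) (hrow : ∀ X, ∑ Y, ‖C X Y‖ ≤ α) (hcol : ∀ Y, ∑ X, ‖C X Y‖ ≤ α) {ρ : ℝ} (hρ : 0 < ρ)
    (hθ : Real.exp 1 * α * normV Γ κ ρ (fun m' => N (2 * m')) / κ ^ 2 < 1)
    {s : ℝ} (hs : ∀ A B, ‖C A B‖ ≤ s) {k : ℕ} (hk : grassmannLaplacian 𝕜 C ^ k = 0) :
    IsUnit (effPartitionFn 𝕜 C W) ∧ ∀ {m : ℕ}, 0 < m → ∀ (i : Fin m) (w : Γ),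
      ∑ X ∈ univ.filter (fun X : Fin m → Γ => X i = w), ‖kernel 𝕜 (effAction 𝕜 C W) m X - kernel 𝕜 W m X‖ ≤
        ∑ j ∈ Ico 1 k, ((m + 2 * j)! : ℝ) / ((m ! : ℝ) * (j ! : ℝ) * 2 ^ j) * s ^ j * N (m + 2 * j) +
          ρ⁻¹ ^ m * (Real.exp 1 * normV Γ κ ρ (fun m' => N (2 * m'))) *
            (Real.exp 1 * α * normV Γ κ ρ (fun m' => N (2 * m')) / κ ^ 2) /
              (1 - Real.exp 1 * α * normV Γ κ ρ (fun m' => N (2 * m')) / κ ^ 2) := by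
  -- the nonlinear part (second order) and the unit
  obtain ⟨hunit, hnl⟩ := sum_norm_kernel_effAction_sub_gaussConv_le_of_gramBounded C hκ hGB W hW hW0 (fun m' => N (2 * m'))
    (fun m' => hN0 _) (fun m' j w => hN (2 * m') j w) hα hrow hcol hρ hθ
  refine ⟨hunit, @fun m hm i w => ?_⟩
  -- the linear part (Wick self-contractions)
  have hlin := sum_norm_kernel_gaussConv_sub_le C hk hs W N hN m i w
  have hksub : ∀ (A B : GrassmannAlgebra 𝕜 Γ) (X : Fin m → Γ), kernel 𝕜 (A - B) m X = kernel 𝕜 A m X - kernel 𝕜 B m X := by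
    intro A B X
    rw [sub_eq_add_neg, kernel_add, ← neg_one_smul 𝕜 B, kernel_smul, neg_one_mul, ← sub_eq_add_neg]
  have hsplit : ∀ X : Fin m → Γ, kernel 𝕜 (effAction 𝕜 C W) m X - kernel 𝕜 W m X =
      kernel 𝕜 (effAction 𝕜 C W - gaussConv 𝕜 C W) m X + kernel 𝕜 (gaussConv 𝕜 C W - W) m X := by
    intro X
    rw [hksub, hksub]
    ring
  calc ∑ X ∈ univ.filter (fun X : Fin m → Γ => X i = w), ‖kernel 𝕜 (effAction 𝕜 C W) m X - kernel 𝕜 W m X‖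
      ≤ ∑ X ∈ univ.filter (fun X : Fin m → Γ => X i = w),
          (‖kernel 𝕜 (effAction 𝕜 C W - gaussConv 𝕜 C W) m X‖ + ‖kernel 𝕜 (gaussConv 𝕜 C W - W) m X‖) :=
        sum_le_sum fun X _ => by rw [hsplit]; exact norm_add_le _ _
    _ = ∑ X ∈ univ.filter (fun X : Fin m → Γ => X i = w), ‖kernel 𝕜 (effAction 𝕜 C W - gaussConv 𝕜 C W) m X‖ +
          ∑ X ∈ univ.filter (fun X : Fin m → Γ => X i = w), ‖kernel 𝕜 (gaussConv 𝕜 C W - W) m X‖ := sum_add_distrib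
    _ ≤ _ := by rw [add_comm]; exact add_le_add hlin (hnl hm i w)

end Literature.MathematicalPhysics.QuantumLattice

end
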